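import Literature.MathematicalPhysics.QuantumFieldTheory.Balaban1983to89.B8Ineq165AllLevels
import Literature.MathematicalPhysics.QuantumFieldTheory.Balaban1983to89.B7AvgGaugeCovariance
import Literature.MathematicalPhysics.QuantumFieldTheory.Balaban1983to89.B8Prop6OfThm4

/-!
# `Balaban1983to89.B8Ineq165AllLevelsIndexLaw` — [Balaban1985RegularSpaces] (1.65) p. 87: the tower decomposition (1.6) AT EVERY LEVEL
# (hypothesis `h16` of `B8Ineq165AllLevels.norm_avg_sub_le_allLevels_of135`, index law №11 of the N05 prototype) is NECESSARY —
# a kernel counter-member on which (1.33), (1.34), (1.35)-on-Λ_j and (1.6) AT LEVEL 0 hold while (1.66) FAILS at level 1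

statement-level skeleton of published theorems with citation tags; proofs where landed; nothing here is a claim about the
Yang–Mills mass gap

PDF held: `paper:balaban1985-cmp99-regular-spaces-gauge-fixing` (journal page = PDF page + 74); p. 77 ((1.3)–(1.7)), p. 82 ((1.33)–(1.35)),
p. 87 ((1.65)–(1.66)); [Balaban1985Averaging] (11) p. 19, (43) p. 24 (gauge covariance of the averages).

WHY THIS FILE (cell `pub-ymgap`, seat `pub-ymgap-dag-n05-a` g6, KNIT seat of DAG node N05 = [B8]; count-neutral; located design point №11,
bus [DAGN05A-G6-ONLINE], adopted at the NODE 00 pin `Node00/CarriersB8` v1.1 §2c as a sub-family law).  `norm_avg_sub_le_allLevels_of135`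
derives (1.66) at every level from (1.33)–(1.35) for region sequences carrying print's (1.6) `Ω_ℓ^{(ℓ)} = ⋃_{i ≥ ℓ} B^{i−ℓ}(Λ_i)` at EVERY
level `ℓ` (`h16`); the prototype index `B8LeafModelZd.ZdIdx` carries it only at level `0` (`hpart`).  This file certifies in the kernel
that the extra law is not decoration: on `ℤ²` with `Ω_j = ℤ²` for all `j`, `Λ_0 = ℤ²`, `Λ_j = ∅` (`j ≥ 1`), `k = 1`, `L = 2` — a datum
satisfying every `ZdIdx` law including `hpart` — the background `U₀ = 1` and the PURE GAUGE `U′ = 1^{g}`, `g(x) = e^{iθx₀}`, `θ = 1/10`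
(a constant abelian field `e^{−iθ}` in direction `0`), satisfy (1.33), (1.34) (all plaquette and derivative conditions of `𝔄_k` hold for
`1` and its gauge transforms; `Ax_k` is vacuous), (1.35) on Λ_j with `α₁ = |e^{−iθ} − 1| = 2 sin(θ/2)` (level `0`; levels `≥ 1` vacuous),
and the windows of (1.65) for every small `α₀`; yet at level `1` the averages (43) of `U′` are the gauge transform by `g(2·)`
([Balaban1985Averaging] (11): `\overline{V^u} = V̄^{u(L·)}`, `B7AvgGaugeCovariance.avgIter_gaugeAct`), i.e. the constant `e^{−2iθ}`, and
`|e^{−2iθ} − 1| = 2 sin θ > 11d²α₀ + 2 sin(θ/2)`.  So no descent to (1.66) at the coarse levels is possible from the layer form of (1.35)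
without locating the coarse blocks inside towers — exactly what (1.6) at every level supplies.

WHAT IS PROVED (kernel, 0 sorry, theorems only): **`exists_counterexample_allLevels_without_h16`** — every hypothesis of
`norm_avg_sub_le_allLevels_of135` EXCEPT `h16` (and, in addition, `hpart`) is exhibited on one member together with a level-`1` bond whose
box lies in `Ω_1` and `‖(U′U₀)‾¹ − Ū₀¹‖ > 11d²α₀ + α₁` there.

HONEST SCOPE.  A typing/necessity certificate about the tree's index (what the pin must carry), nothing of print refuted ((1.6) holds at
every level for print's region sequences (1.3)–(1.5)); carriers `ℤ² × ℂ`.  Count-neutral; N05 NOT discharged; nothing continuum / ℝ⁴ / OS /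
mass-gap / Clay.  Unit `pub-ymgap-dag-n05-a` (g6), 2026-08-26.
-/

noncomputable section

open scoped BigOperators
open Complex (I exp)

namespace Literature.MathematicalPhysics.QuantumFieldTheory.Balaban1983to89.B8Ineq165AllLevelsIndexLaw

open B7Prop1Explicit B7Prop2Explicit B7Prop1Local B8Lemma1NonAbelian B8Ineq130
open B7Prop2Explicit (C0 c2' C0_pos c2'_pos)
open B8Ineq132 (InAk BondTouches)
open B8Eq119TwistedAxial (InAx)
open B7AvgGaugeCovariance (uLev avgIter_gaugeAct)
open B8Prop6OfThm4 (one_inAk)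

-- `Site` alone would resolve to the torus sites of `Setup.lean`; re-export the `ℤ^d` sites of `B7Prop1Explicit`.
export B7Prop1Explicit (Site)

/-! ## §1 The phase gauge function `g(x) = e^{iθx₀}` on `ℤ²` with values in `ℂˣ` -/

/-- The phase `e^{it}` as a unit of `ℂ` (through the tree's `expUnit`). [folklore] -/
private theorem val_phase (z : ℂ) : ((expUnit z : ℂˣ) : ℂ) = exp z := by
  simp [expUnit, Complex.exp_eq_exp_ℂ]

/-- `e^{it}` is unitary for real `t`. [folklore] -/
private theorem phase_mem_unitaryUnits (t : ℝ) : expUnit (I * (t : ℂ)) ∈ unitaryUnits ℂ := by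
  rw [mem_unitaryUnits, val_phase, Unitary.mem_iff]
  have hconj : starRingEnd ℂ (exp (I * (t : ℂ))) = exp (-(I * (t : ℂ))) := by
    rw [← Complex.exp_conj, map_mul, Complex.conj_I, Complex.conj_ofReal, neg_mul]
  have h1 : exp (-(I * (t : ℂ))) * exp (I * (t : ℂ)) = 1 := by rw [← Complex.exp_add, neg_add_cancel, Complex.exp_zero]
  have h2 : exp (I * (t : ℂ)) * exp (-(I * (t : ℂ))) = 1 := by rw [← Complex.exp_add, add_neg_cancel, Complex.exp_zero]
  refine ⟨?_, ?_⟩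
  · show starRingEnd ℂ (exp (I * (t : ℂ))) * exp (I * (t : ℂ)) = 1
    rw [hconj]; exact h1
  · show exp (I * (t : ℂ)) * starRingEnd ℂ (exp (I * (t : ℂ))) = 1
    rw [hconj]; exact h2

/-- `e^{is}(e^{it})⁻¹ = e^{i(s − t)}` in `ℂ`. [folklore] -/
private theorem val_phase_mul_inv (s t : ℝ) :
    ((expUnit (I * (s : ℂ)) * (expUnit (I * (t : ℂ)))⁻¹ : ℂˣ) : ℂ) = exp (I * ((s - t : ℝ) : ℂ)) := by
  rw [Units.val_mul, Units.val_inv_eq_inv_val, val_phase, val_phase, ← div_eq_mul_inv, ← Complex.exp_sub]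
  congr 1
  push_cast
  ring

/-! ## §2 The counter-member -/

/-- **(1.6) AT EVERY LEVEL IS NECESSARY FOR THE DESCENT (1.65) ⇒ (1.66)** (index law №11 of the N05 prototype): there are `L = 2`, `k = 1`,
`η = 1`, `Ω_j = ℤ²` (all `j`), `Λ_0 = ℤ²`, `Λ_j = ∅` (`j ≥ 1`), unitary `U₀ = 1`, `U′ = 1^{g}` (`g(x) = e^{ix₀/10}`) and `α₀ > 0`, `α₁ ≥ 0` such
that EVERY hypothesis of `B8Ineq165AllLevels.norm_avg_sub_le_allLevels_of135` other than `h16` holds — windows, `Ω` antitone, towers in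
`Ω_j`, the level-`0` partition `hpart` (every site is its own level-`0` tower), (1.33) `U₀ ∈ 𝔄_1`, (1.34) `U′U₀ ∈ 𝔄_1 ∩ Ax_1(𝔅_1, U₀)`, (1.35) ON
Λ_j (touching form) — while at the level-`1` bond `⟨0, e_0⟩` (box in `Ω_1 = ℤ²`) `‖(U′U₀)‾¹ − Ū₀¹‖ > 11d²α₀ + α₁` (`d = 2`).  The averages of
the pure gauge are computed by [Balaban1985Averaging] (11) (`avgIter_gaugeAct`): `(1^{g})‾¹ = 1^{g(2·)}`, the constant `e^{−2iθ}` in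
direction `0`, and `|e^{−2iθ} − 1| = 2 sin θ > 44α₀ + 2 sin(θ/2) = 44α₀ + |e^{−iθ} − 1|`. [cite: Balaban1985RegularSpaces, (1.65)–(1.66) p.87, (1.3)–(1.6) p.77, (1.33)–(1.35) p.82; Balaban1985Averaging, (11) p.19, (43) p.24] -/
theorem exists_counterexample_allLevels_without_h16 :
    ∃ (L k : ℕ) (η α₀ α₁ : ℝ) (Ω : ℕ → Set (Site 2)) (Λs : ℕ → Set (Site 2)) (U₀ U' : Site 2 → Fin 2 → ℂˣ),
      2 ≤ L ∧ 1 ≤ k ∧ 0 < η ∧ (∀ x κ, U₀ x κ ∈ unitaryUnits ℂ) ∧ (∀ x κ, U' x κ ∈ unitaryUnits ℂ) ∧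
      0 < α₀ ∧ C0 2 * α₀ ≤ 1 / 3 ∧ 2 * α₀ ≤ c2' 2 L ∧ 0 ≤ α₁ ∧ 11 * ((2 : ℕ) : ℝ) ^ 2 * α₀ + α₁ ≤ 1 / 6 ∧
      (∀ j, Ω (j + 1) ⊆ Ω j) ∧
      (∀ j, j ≤ k → ∀ y ∈ Λs j, ∀ x, InBox (tlo L y j) (thi L y j) x → x ∈ Ω j) ∧
      (∀ x : Site 2, ∃ j, j ≤ k ∧ ∃ y ∈ Λs j, InBox (tlo L y j) (thi L y j) x) ∧
      InAk L k η α₀ Ω U₀ ∧ InAk L k η α₀ Ω (mulCfg U' U₀) ∧ InAx L k Λs U₀ (mulCfg U' U₀) ∧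
      (∀ j, j ≤ k → ∀ (z : Site 2) (μ : Fin 2), BondTouches (Λs j) z μ →
        (∀ x, InBox (loK L j z) (bondHiK L j z μ) x → x ∈ Ω j) →
        ‖(avgIter L (mulCfg U' U₀) j z μ : ℂ) - (avgIter L U₀ j z μ : ℂ)‖ ≤ α₁) ∧
      ∃ (w : Site 2) (ν : Fin 2), 1 ≤ k ∧ (∀ x, InBox (loK L 1 w) (bondHiK L 1 w ν) x → x ∈ Ω 1) ∧
        11 * ((2 : ℕ) : ℝ) ^ 2 * α₀ + α₁ < ‖(avgIter L (mulCfg U' U₀) 1 w ν : ℂ) - (avgIter L U₀ 1 w ν : ℂ)‖ := by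
  classical
  -- the data
  set θ : ℝ := 1 / 10 with hθ_def
  set g : Site 2 → ℂˣ := fun x => expUnit (I * ((θ * (x 0 : ℝ) : ℝ) : ℂ)) with hg_def
  set U' : Site 2 → Fin 2 → ℂˣ := gaugeAct g 1 with hU'_def
  set Ω : ℕ → Set (Site 2) := fun _ => Set.univ with hΩ_def
  set Λs : ℕ → Set (Site 2) := fun j => if j = 0 then Set.univ else ∅ with hΛs_def
  set α₁ : ℝ := ‖exp (I * ((-θ : ℝ) : ℂ)) - 1‖ with hα₁_def
  set α₀ : ℝ := min (1 / 1000) (min (1 / (3 * C0 2)) (c2' 2 2 / 2)) with hα₀_def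
  have hC0 := C0_pos 2
  have hc2 : 0 < c2' 2 2 := c2'_pos 2 2 (by norm_num)
  have hα₀ : 0 < α₀ := lt_min (by norm_num) (lt_min (by positivity) (by positivity))
  have hα₀1 : α₀ ≤ 1 / 1000 := min_le_left _ _
  have hα3 : C0 2 * α₀ ≤ 1 / 3 := by
    have h : α₀ ≤ 1 / (3 * C0 2) := (min_le_right _ _).trans (min_le_left _ _)
    calc C0 2 * α₀ ≤ C0 2 * (1 / (3 * C0 2)) := mul_le_mul_of_nonneg_left h hC0.le
      _ = 1 / 3 := by field_simp
  have hα2 : 2 * α₀ ≤ c2' 2 2 := by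
    have h : α₀ ≤ c2' 2 2 / 2 := (min_le_right _ _).trans (min_le_right _ _)
    linarith
  -- unitarity of `g` and of the pure gauge `U′ = 1^{g}`
  have hg : ∀ x, g x ∈ unitaryUnits ℂ := fun x => phase_mem_unitaryUnits _
  have hg1 : ∀ x, g x ∈ U1 ℂ := fun x => unitaryUnits_le_U1 (hg x)
  have hU' : ∀ x κ, U' x κ ∈ unitaryUnits ℂ := by
    intro x κ
    show g x * (1 : Site 2 → Fin 2 → ℂˣ) x κ * (g (x + e κ))⁻¹ ∈ unitaryUnits ℂ
    exact (unitaryUnits ℂ).mul_mem ((unitaryUnits ℂ).mul_mem (hg x) (unitaryUnits ℂ).one_mem)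
      ((unitaryUnits ℂ).inv_mem (hg _))
  have hmul : mulCfg U' (1 : Site 2 → Fin 2 → ℂˣ) = U' := by
    funext x κ; simp [mulCfg]
  -- the values of the pure gauge: `U′(x, 0) = e^{−iθ}`, `U′(x, 1) = 1`
  have hU'val : ∀ (x : Site 2) (κ : Fin 2), ((U' x κ : ℂˣ) : ℂ) = exp (I * ((-(θ * (e κ (0 : Fin 2) : ℝ)) : ℝ) : ℂ)) := by
    intro x κ
    have h1 : U' x κ = g x * (g (x + e κ))⁻¹ := by
      show g x * (1 : Site 2 → Fin 2 → ℂˣ) x κ * (g (x + e κ))⁻¹ = g x * (g (x + e κ))⁻¹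
      rw [Pi.one_apply, Pi.one_apply, mul_one]
    rw [h1, hg_def, val_phase_mul_inv]
    congr 3
    simp only [Pi.add_apply, Int.cast_add]
    ring
  have hU'0 : ∀ x : Site 2, ((U' x 0 : ℂˣ) : ℂ) = exp (I * ((-θ : ℝ) : ℂ)) := by
    intro x; rw [hU'val]; simp [e_apply]
  have hU'1 : ∀ x : Site 2, ((U' x 1 : ℂˣ) : ℂ) = 1 := by
    intro x; rw [hU'val]; simp [e_apply]
  -- the level-1 averages of the pure gauge: the gauge transform by `g(2·)` of `1̄¹ = 1`
  have hpdev1 : pdev (1 : Site 2 → Fin 2 → ℂˣ) < α₀ * ((((2 : ℕ) : ℝ) ^ 1)⁻¹) ^ 2 := by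
    have h0 : pdev (1 : Site 2 → Fin 2 → ℂˣ) = 0 := by
      simp [pdev, hol_one]
    rw [h0]; positivity
  have havg1 : avgIter 2 U' 1 = gaugeAct (uLev 2 g 1) (1 : Site 2 → Fin 2 → ℂˣ) := by
    have h := avgIter_gaugeAct 2 le_rfl (avgClosed_unitaryUnits 2 2) 1 (1 : Site 2 → Fin 2 → ℂˣ)
      (fun _ _ => (unitaryUnits ℂ).one_mem) (u := g) hg1 hα₀ hα3 hα2 hpdev1 1 le_rfl
    rw [hU'_def, h, B8Ineq132.avgIter_one]
  have havg1val : (((avgIter 2 U' 1) (0 : Site 2) (0 : Fin 2) : ℂˣ) : ℂ) = exp (I * ((-(2 * θ) : ℝ) : ℂ)) := by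
    rw [havg1]
    show (((uLev 2 g 1 0 * (1 : Site 2 → Fin 2 → ℂˣ) 0 0 * (uLev 2 g 1 (0 + e 0))⁻¹ : ℂˣ)) : ℂ) = _
    rw [Pi.one_apply, Pi.one_apply, mul_one]
    simp only [uLev, hg_def, zero_add]
    rw [val_phase_mul_inv]
    congr 3
    simp [e_apply]
    ring
  -- the two norms: `|e^{−iθ} − 1| = 2 sin(θ/2)`, `|e^{−2iθ} − 1| = 2 sin θ`
  have hθpos : 0 < θ := by rw [hθ_def]; norm_num
  have hθpi : θ < Real.pi := by rw [hθ_def]; linarith [Real.pi_gt_three]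
  have hsinθ : 0 < Real.sin θ := Real.sin_pos_of_pos_of_lt_pi hθpos hθpi
  have hsinθ2 : 0 < Real.sin (θ / 2) :=
    Real.sin_pos_of_pos_of_lt_pi (by positivity) (by rw [hθ_def]; linarith [Real.pi_gt_three])
  have hα₁val : α₁ = 2 * Real.sin (θ / 2) := by
    rw [hα₁_def, Complex.norm_exp_I_mul_ofReal_sub_one, Real.norm_eq_abs, neg_div, Real.sin_neg, mul_neg, abs_neg,
      abs_of_pos (by positivity)]
  have hbig : ‖exp (I * ((-(2 * θ) : ℝ) : ℂ)) - 1‖ = 2 * Real.sin θ := by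
    rw [Complex.norm_exp_I_mul_ofReal_sub_one, Real.norm_eq_abs, neg_div, Real.sin_neg, mul_neg, abs_neg,
      show 2 * θ / 2 = θ by ring, abs_of_pos (by positivity)]
  have hα₁nn : 0 ≤ α₁ := norm_nonneg _
  -- numerics at `θ = 1/10`: `2 sin(θ/2) < θ`, `2 sin θ > 2θ − θ³/3`
  have hα₁lt : α₁ < 1 / 10 := by
    rw [hα₁val]
    have h := Real.sin_lt (show 0 < θ / 2 by positivity)
    rw [hθ_def] at h ⊢; linarith
  have hbiglt : 199 / 1000 < 2 * Real.sin θ := by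
    have h := Real.sin_gt_sub_cube hθpos
    rw [hθ_def] at h ⊢; nlinarith
  refine ⟨2, 1, 1, α₀, α₁, Ω, Λs, 1, U', le_rfl, le_rfl, one_pos, fun _ _ => (unitaryUnits ℂ).one_mem, hU', hα₀, hα3, hα2,
    hα₁nn, ?_, fun _ => le_rfl, fun _ _ _ _ _ _ => Set.mem_univ _, fun x => ⟨0, Nat.zero_le _, x, by simp [hΛs_def], fun i => ?_⟩,
    one_inAk (L := 2) (by norm_num) 1 one_pos hα₀ Ω, ?_, ?_, ?_, ⟨0, 0, le_rfl, fun _ _ => Set.mem_univ _, ?_⟩⟩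
  · -- the window `11d²α₀ + α₁ ≤ 1/6`
    push_cast; linarith
  · -- `x ∈ B⁰(x)`
    simp
  · -- (1.34), `𝔄`-part: gauge invariance of `𝔄_k`
    rw [hmul, hU'_def]
    exact (B8Ineq132.inAk_gaugeAct_iff 2 1 1 α₀ Ω hg1 _).2 (one_inAk (L := 2) (by norm_num) 1 one_pos hα₀ Ω)
  · -- (1.34), axial part: vacuous (`Λ_j = ∅` for `j ≥ 1`)
    intro j hj1 _ xj hxj
    have : Λs j = ∅ := by simp [hΛs_def, Nat.one_le_iff_ne_zero.mp hj1]
    rw [this] at hxj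
    exact absurd hxj (Set.notMem_empty _)
  · -- (1.35) on Λ_j: level 0 on every bond, levels ≥ 1 vacuous
    intro j hj z μ htouch _
    rcases Nat.eq_zero_or_pos j with rfl | hjpos
    · rw [hmul, avgIter_zero, avgIter_zero, Pi.one_apply, Pi.one_apply, Units.val_one]
      by_cases hμ : μ = 0
      · subst hμ; rw [hU'0]
      · rw [Fin.eq_one_of_ne_zero μ hμ, hU'1, sub_self, norm_zero]; exact hα₁nn
    · have : Λs j = ∅ := by simp [hΛs_def, Nat.pos_iff_ne_zero.mp hjpos]
      rw [this] at htouch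
      rcases htouch with h | h <;> exact absurd h (Set.notMem_empty _)
  · -- the violation at the level-1 bond `⟨0, e_0⟩`
    rw [hmul, B8Ineq132.avgIter_one, Pi.one_apply, Pi.one_apply, Units.val_one, havg1val, hbig]
    push_cast
    linarith

#print axioms exists_counterexample_allLevels_without_h16

end Literature.MathematicalPhysics.QuantumFieldTheory.Balaban1983to89.B8Ineq165AllLevelsIndexLaw

end
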